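import Literature.Geometry.Lorentzian.ConicBogovskiiDelta
import Mathlib.Analysis.Calculus.ContDiff.Convolution
import HarnessLib

/-!
# The conic solution operators `S_c`, `T_c` of Mao–Oh–Tao's Lemma 2.5

(trunk G08 = T-LORENTZ; family `gr`; namespace `Literature.Geometry.Lorentzian.MaoOhTao`.)

Mao–Oh–Tao (arXiv:2308.13031), Lemma 2.5: for a profile `κ` on the unit sphere with `∫_{S²} κ = 1` supported in
`ω ⊆ 𝕊²`, the operator `(S_c f)^{ij} = K^{ij}_κ ⋆ f`, `K^{ij}_κ(z) = κ(z/|z|) zⁱzʲ/|z|³`, satisfies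
(S_c1) `supp S_c f ⊆ C_ω` when `supp f ⊆ C_ω` (the cone over `ω`), (S_c2) `∂_i∂_j (S_c f)^{ij} = f`, and
(S_c3) weighted Sobolev bounds.  This file realises `S_c` with Mathlib's convolution
(`MeasureTheory.convolution`, `(K ⋆[mul, volume] f)(x) = ∫ K(t) f(x − t) dt`) for a profile `κ : ℝ³ → ℝ` continuous
and `0`-homogeneous off the origin, and proves, for `f ∈ C²_c(ℝ³)`:

* `locallyIntegrable_conicKernel` — `K^{ij}_κ ∈ L¹_loc(ℝ³)` (`|K^{ij}_κ| ≤ sup|κ| · |z|⁻¹`);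
* `pd_convolution_eq`, `pd_pd_convolution_eq` — `∂_l (K ⋆ f) = K ⋆ ∂_l f`, `∂_j∂_i (K ⋆ f) = K ⋆ ∂_j∂_i f` for
  `K ∈ L¹_loc`, `f ∈ C¹_c` resp. `C²_c` (Mathlib's `HasCompactSupport.hasFDerivAt_convolution_right`);
* `contDiff_convolution_conicKernel` — `S_c f ∈ C^n` for `f ∈ C^n_c`;
* `support_convolution_conicKernel_subset` — **(S_c1)**: `supp (S_c f)^{ij} ⊆ C` for a convex cone `C ⊇ supp κ, supp f`;
* `sum_sum_pd_pd_convolution_conicKernel_eq'` — **(S_c2)**: `Σ_{i,j} ∂_i∂_j (K^{ij}_κ ⋆ f)(x) = f(x) ∫_{S²} κ dσ` for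
  every `x ∈ ℝ³` (`= f(x)` for a normalised profile, `…_eq_self`), from the weak identity
  `Σ_{i,j} ∫ K^{ij}_κ(z) ∂ⱼ∂ᵢf(x − z) dz = f(x) ∫_{S²} κ` of `ConicBogovskiiDelta.lean`.

The vector operator `T_c` of Lemma 2.5 (kernel `(K_κ)^{ij}_k`, written in divergence form `Σ_m ∂_m M^{ijm}_k` in
`ConicBogovskiiKernel.sum_pd_conicKernelT`) is realised on `C²_c` fields as `(T_c 𝐟)^{ij} = Σ_{k,m} M^{ijm}_k ⋆ ∂_m 𝐟^k`:

* `sum_sum_integral_conicKernelT_pd_pd_eq` — the weak identity `Σ_{i,m} ∫ M^{ijm}_k ∂_i∂_m φ = δ_{jk} φ(0) ∫_{S²} κ`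
  (`Σ_i ∂_i (K_κ)^{ij}_k = δ^j_k δ₀`);
* `sum_pd_convolution_conicKernelT_eq` — **(T_c2)**: `Σ_i ∂_i (T_c 𝐟)^{ij} = 𝐟^j ∫_{S²} κ` pointwise (`= 𝐟^j` when
  `∫_{S²} κ = 1`, `…_eq_self`); `support_convolution_conicKernelT_subset` — **(T_c1)**.

Everything is proved; no definitions, no named facts.  Not treated: (S_c3), (T_c3) (the weighted `H^{s,δ}` bounds, a
pseudo-differential estimate) and the identification of the divergence form of `T_c` with the convolution against the
degree `−2` kernel `(K_κ)^{ij}_k` itself (an integration by parts with vanishing boundary term).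

## References

* Y. Mao, S.-J. Oh, T. Tao, *Initial data gluing in the asymptotically flat regime via solution operators with
  prescribed support properties*, arXiv:2308.13031 (2023), Lemma 2.5 and Remark 2.6 (key `MaoOhTao2023`).
-/

noncomputable section

open scoped RealInnerProductSpace Topology ContDiff
open Filter MeasureTheory Set Metric Function
open Literature.Analysis.FluidPDE

namespace Literature.Geometry.Lorentzian

namespace MaoOhTao

/-- `|zᵢ| ≤ |z|` (a private copy of a FluidPDE helper). [folklore] -/
private theorem abs_apply_le_norm (v : E3) (i : Fin 3) : |v i| ≤ ‖v‖ := by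
  simpa using PiLp.norm_apply_le v i

/-! ### The conic solution operator `S_c f = K_κ ⋆ f` -/

section SolutionOperator

open scoped Convolution

variable {κ f : E3 → ℝ}

/-- **The kernels `K^{ij}_κ = κ zⁱzʲ/|z|³` are locally integrable** (`|K^{ij}_κ| ≤ sup|κ| · |z|⁻¹`, Mathlib's
`locallyIntegrable_of_norm_le_rpow`). [folklore] -/
theorem locallyIntegrable_conicKernel (hκ : ContinuousOn κ {0}ᶜ)
    (hhom : ∀ y : E3, y ≠ 0 → ∀ t : ℝ, 0 < t → κ (t • y) = κ y) (i j : Fin 3) :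
    LocallyIntegrable (fun z : E3 ↦ κ z * (z i * (z j * (‖z‖ ^ 3)⁻¹))) volume := by
  obtain ⟨W, hW⟩ := exists_abs_le_of_homogeneous hκ hhom
  have hcont : ContinuousOn (fun z : E3 ↦ κ z * (z i * (z j * (‖z‖ ^ 3)⁻¹))) {0}ᶜ := by
    refine hκ.mul ((EuclideanSpace.proj (𝕜 := ℝ) i).continuous.continuousOn.mul
      ((EuclideanSpace.proj (𝕜 := ℝ) j).continuous.continuousOn.mul
        (ContinuousOn.inv₀ ((continuous_norm.pow 3).continuousOn) fun z hz ↦ ?_)))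
    exact pow_ne_zero 3 (norm_ne_zero_iff.2 (mem_compl_singleton_iff.1 hz))
  have hmeas : AEStronglyMeasurable (fun z : E3 ↦ κ z * (z i * (z j * (‖z‖ ^ 3)⁻¹))) volume := by
    have h := hcont.aestronglyMeasurable (μ := (volume : Measure E3))
      (measurableSet_singleton (0 : E3)).compl
    rwa [restrict_compl_singleton] at h
  refine locallyIntegrable_of_norm_le_rpow (by rw [finrank_euclideanSpace_fin]; norm_num) (C := W)
    (α := 1) (by rw [finrank_euclideanSpace_fin]; norm_num) (Eventually.of_forall fun z ↦ ?_) hmeas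
  by_cases hz : z = 0
  · subst hz
    simp only [PiLp.zero_apply, zero_mul, mul_zero, norm_zero,
      Real.zero_rpow (show (-(1 : ℝ)) ≠ 0 by norm_num), le_refl]
  · have hn : 0 < ‖z‖ := norm_pos_iff.2 hz
    have hW0 : 0 ≤ W := (abs_nonneg _).trans (hW z hz)
    rw [Real.rpow_neg hn.le, Real.rpow_one, Real.norm_eq_abs]
    simp only [abs_mul, abs_inv, abs_pow, abs_norm]
    calc |κ z| * (|z i| * (|z j| * (‖z‖ ^ 3)⁻¹)) ≤ W * (‖z‖ * (‖z‖ * (‖z‖ ^ 3)⁻¹)) :=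
          mul_le_mul (hW z hz) (mul_le_mul (abs_apply_le_norm z i)
            (mul_le_mul_of_nonneg_right (abs_apply_le_norm z j) (by positivity)) (by positivity)
            (norm_nonneg _)) (by positivity) hW0
      _ = W * ‖z‖⁻¹ := by field_simp

/-- **Differentiating a convolution with a `C¹_c` function**: for `K` locally integrable and `f ∈ C¹_c(ℝ³)`,
`∂_l (K ⋆ f) = K ⋆ ∂_l f` pointwise, the convolution being Mathlib's `(K ⋆ f)(x) = ∫ K(t) f(x − t) dt`
(`HasCompactSupport.hasFDerivAt_convolution_right`, `convolution_precompR_apply`). [folklore] -/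
theorem pd_convolution_eq {K : E3 → ℝ} (hK : LocallyIntegrable K volume) (hf : ContDiff ℝ 1 f)
    (hfc : HasCompactSupport f) (l : Fin 3) (x : E3) :
    pd l (K ⋆[ContinuousLinearMap.mul ℝ ℝ, volume] f) x =
      (K ⋆[ContinuousLinearMap.mul ℝ ℝ, volume] pd l f) x := by
  rw [pd, (hfc.hasFDerivAt_convolution_right (ContinuousLinearMap.mul ℝ ℝ) hK hf x).fderiv,
    convolution_precompR_apply (ContinuousLinearMap.mul ℝ ℝ) hK (hfc.fderiv (𝕜 := ℝ))
      (hf.continuous_fderiv one_ne_zero) x (e l)]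
  rfl

/-- Second order: `∂_j ∂_i (K ⋆ f) = K ⋆ ∂_j∂_i f` for `f ∈ C²_c(ℝ³)`. [folklore] -/
theorem pd_pd_convolution_eq {K : E3 → ℝ} (hK : LocallyIntegrable K volume) (hf : ContDiff ℝ 2 f)
    (hfc : HasCompactSupport f) (i j : Fin 3) (x : E3) :
    pd j (pd i (K ⋆[ContinuousLinearMap.mul ℝ ℝ, volume] f)) x =
      (K ⋆[ContinuousLinearMap.mul ℝ ℝ, volume] pd j (pd i f)) x := by
  have h1 : pd i (K ⋆[ContinuousLinearMap.mul ℝ ℝ, volume] f) =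
      K ⋆[ContinuousLinearMap.mul ℝ ℝ, volume] pd i f :=
    funext fun y ↦ pd_convolution_eq hK (hf.of_le one_le_two) hfc i y
  rw [h1]
  exact pd_convolution_eq hK (contDiff_pd (n := 1) hf i) (hasCompactSupport_pd hfc i) j x

/-- **`S_c f` is as smooth as `f`**: the components `(S_c f)^{ij} = K^{ij}_κ ⋆ f` of the conic solution operator are
`C^n` for `f ∈ C^n_c(ℝ³)` (`HasCompactSupport.contDiff_convolution_right`). [cite: MaoOhTao2023, Lemma 2.5] -/
theorem contDiff_convolution_conicKernel (hκ : ContinuousOn κ {0}ᶜ)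
    (hhom : ∀ y : E3, y ≠ 0 → ∀ t : ℝ, 0 < t → κ (t • y) = κ y) {n : ℕ∞} (hf : ContDiff ℝ n f)
    (hfc : HasCompactSupport f) (i j : Fin 3) :
    ContDiff ℝ n ((fun z : E3 ↦ κ z * (z i * (z j * (‖z‖ ^ 3)⁻¹))) ⋆[ContinuousLinearMap.mul ℝ ℝ, volume] f) :=
  hfc.contDiff_convolution_right (ContinuousLinearMap.mul ℝ ℝ) (locallyIntegrable_conicKernel hκ hhom i j) hf

/-- **(S_c1) for `S_c f = K_κ ⋆ f`**: if `κ` (hence every `K^{ij}_κ`) and `f` are supported in a convex cone `C`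
(closed under addition), so is `(S_c f)^{ij}` (Mathlib's `support_convolution_subset`: `supp (K ⋆ f) ⊆ supp K + supp f`).
[cite: MaoOhTao2023, Lemma 2.5 (S_c1)] -/
theorem support_convolution_conicKernel_subset {C : Set E3} (hC : ∀ a ∈ C, ∀ b ∈ C, a + b ∈ C)
    (hκC : ∀ z, κ z ≠ 0 → z ∈ C) (hfC : ∀ y, f y ≠ 0 → y ∈ C) (i j : Fin 3) :
    support ((fun z : E3 ↦ κ z * (z i * (z j * (‖z‖ ^ 3)⁻¹))) ⋆[ContinuousLinearMap.mul ℝ ℝ, volume] f) ⊆ C := by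
  refine (support_convolution_subset (ContinuousLinearMap.mul ℝ ℝ)).trans ?_
  rintro x ⟨a, ha, b, hb, rfl⟩
  exact hC a (hκC a (left_ne_zero_of_mul ha)) b (hfC b hb)

/-- The value of `S_c f`: `(K^{ij}_κ ⋆ f)(x) = ∫ K^{ij}_κ(t) f(x − t) dt = ∫ K^{ij}_κ(x − y) f(y) dy`
(`convolution_mul`, `convolution_eq_swap`). [cite: MaoOhTao2023, Lemma 2.5] -/
theorem convolution_conicKernel_eq (κ f : E3 → ℝ) (i j : Fin 3) (x : E3) :
    ((fun z : E3 ↦ κ z * (z i * (z j * (‖z‖ ^ 3)⁻¹))) ⋆[ContinuousLinearMap.mul ℝ ℝ, volume] f) x =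
      ∫ y : E3, κ (x - y) * ((x - y) i * ((x - y) j * (‖x - y‖ ^ 3)⁻¹)) * f y := by
  rw [convolution_eq_swap]
  rfl

/-- **(S_c2): `∂_i∂_j (S_c f)^{ij} = f`** (Mao–Oh–Tao, Lemma 2.5, for `f ∈ C²_c(ℝ³)` and a profile `κ` continuous and
`0`-homogeneous off the origin; the general constant is `∫_{S²} κ dσ`): with `(S_c f)^{ij} = K^{ij}_κ ⋆ f`,
`Σ_{i,j} ∂_j∂_i (K^{ij}_κ ⋆ f)(x) = f(x) ∫_{S²} κ dσ` for every `x` — the derivatives fall on `f`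
(`pd_pd_convolution_eq`) and `sum_sum_integral_conicKernel_pd_pd_sub_eq` applies.
[cite: MaoOhTao2023, Lemma 2.5 (S_c2) and Remark 2.6] -/
theorem sum_sum_pd_pd_convolution_conicKernel_eq (hκ : ContinuousOn κ {0}ᶜ)
    (hhom : ∀ y : E3, y ≠ 0 → ∀ t : ℝ, 0 < t → κ (t • y) = κ y) (hf : ContDiff ℝ 2 f)
    (hfc : HasCompactSupport f) (x : E3) :
    ∑ i, ∑ j, pd j (pd i ((fun z : E3 ↦ κ z * (z i * (z j * (‖z‖ ^ 3)⁻¹)))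
      ⋆[ContinuousLinearMap.mul ℝ ℝ, volume] f)) x =
      f x * ∫ α, κ (α : E3) ∂(volume : Measure E3).toSphere := by
  rw [← sum_sum_integral_conicKernel_pd_pd_sub_eq hκ hhom hf hfc x]
  refine Finset.sum_congr rfl fun i _ ↦ Finset.sum_congr rfl fun j _ ↦ ?_
  rw [pd_pd_convolution_eq (locallyIntegrable_conicKernel hκ hhom i j) hf hfc i j x, convolution_mul]

/-- **(S_c2) in the printed index order**: `Σ_{i,j} ∂_i∂_j (K^{ij}_κ ⋆ f)(x) = f(x) ∫_{S²} κ dσ` (the kernel is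
symmetric in `i, j`). [cite: MaoOhTao2023, Lemma 2.5 (S_c2)] -/
theorem sum_sum_pd_pd_convolution_conicKernel_eq' (hκ : ContinuousOn κ {0}ᶜ)
    (hhom : ∀ y : E3, y ≠ 0 → ∀ t : ℝ, 0 < t → κ (t • y) = κ y) (hf : ContDiff ℝ 2 f)
    (hfc : HasCompactSupport f) (x : E3) :
    ∑ i, ∑ j, pd i (pd j ((fun z : E3 ↦ κ z * (z i * (z j * (‖z‖ ^ 3)⁻¹)))
      ⋆[ContinuousLinearMap.mul ℝ ℝ, volume] f)) x =
      f x * ∫ α, κ (α : E3) ∂(volume : Measure E3).toSphere := by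
  have hK : ∀ i j : Fin 3, (fun z : E3 ↦ κ z * (z i * (z j * (‖z‖ ^ 3)⁻¹))) =
      fun z ↦ κ z * (z j * (z i * (‖z‖ ^ 3)⁻¹)) := fun i j ↦ funext fun z ↦ by ring
  rw [Finset.sum_comm]
  exact (Finset.sum_congr rfl fun j _ ↦ Finset.sum_congr rfl fun i _ ↦ by rw [hK i j]).trans
    (sum_sum_pd_pd_convolution_conicKernel_eq hκ hhom hf hfc x)

/-- **(S_c2), normalised profile**: `Σ_{i,j} ∂_i∂_j (K^{ij}_κ ⋆ f) = f` on `ℝ³` when `∫_{S²} κ dσ = 1`, for every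
`f ∈ C²_c(ℝ³)`: the conic operator `S_c` of Lemma 2.5 is a right inverse of the double divergence on `C²_c`.
[cite: MaoOhTao2023, Lemma 2.5 (S_c2)] -/
theorem sum_sum_pd_pd_convolution_conicKernel_eq_self (hκ : ContinuousOn κ {0}ᶜ)
    (hhom : ∀ y : E3, y ≠ 0 → ∀ t : ℝ, 0 < t → κ (t • y) = κ y)
    (hκ1 : ∫ α, κ (α : E3) ∂(volume : Measure E3).toSphere = 1) (hf : ContDiff ℝ 2 f)
    (hfc : HasCompactSupport f) (x : E3) :
    ∑ i, ∑ j, pd i (pd j ((fun z : E3 ↦ κ z * (z i * (z j * (‖z‖ ^ 3)⁻¹)))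
      ⋆[ContinuousLinearMap.mul ℝ ℝ, volume] f)) x = f x := by
  rw [sum_sum_pd_pd_convolution_conicKernel_eq' hκ hhom hf hfc x, hκ1, mul_one]

end SolutionOperator

/-! ### The vector operator `T_c` in divergence form

Lemma 2.5 also inverts the symmetric divergence `π ↦ ∂_i π^{ij}` on the cone by `(T_c 𝐟)^{ij} = Σ_k (K_κ)^{ij}_k ⋆ 𝐟^k`
with `(K_κ)^{ij}_k = −½ ∂_kκ zⁱzʲ/|z|³ + …`.  `ConicBogovskiiKernel.sum_pd_conicKernelT` writes this kernel in divergence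
form, `(K_κ)^{ij}_k = Σ_m ∂_m M^{ijm}_k` with `M^{ijm}_k = δ^j_k K^{im}_κ + δ^i_k K^{jm}_κ − δ^m_k K^{ji}_κ` built from the
locally integrable kernels `K^{ab}_κ = κ z^a z^b/|z|³`; accordingly we realise `T_c` on `C²_c` vector fields with the
derivative `∂_m` carried by the field, `(T_c 𝐟)^{ij} := Σ_{k,m} M^{ijm}_k ⋆ ∂_m 𝐟^k`, and prove (T_c2) in this form:
`Σ_i ∂_i (T_c 𝐟)^{ij} = 𝐟^j ∫_{S²} κ dσ` pointwise.  The weak identity behind it,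
`Σ_{i,m} ∫ M^{ijm}_k ∂_i∂_m φ = δ_{jk} φ(0) ∫_{S²} κ`, is (S_c2) for the `δ^j_k`-term plus the symmetry of `K^{ab}_κ` and
of mixed partials for the other two ("simple computations similar to above", Remark 2.6). -/

section VectorOperator

open scoped Convolution

variable {κ φ : E3 → ℝ}

/-- All pairings `∫ κ z_a z_b |z|⁻³ ∂_c∂_d φ` converge absolutely for `φ ∈ C²_c(ℝ³)`. [folklore] -/
theorem integrable_conicKernel_mul_pd_pd' (hκ : ContinuousOn κ {0}ᶜ)
    (hhom : ∀ y : E3, y ≠ 0 → ∀ t : ℝ, 0 < t → κ (t • y) = κ y) (hφ : ContDiff ℝ 2 φ)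
    (hφc : HasCompactSupport φ) (a b c d : Fin 3) :
    Integrable fun z : E3 ↦ κ z * (z a * (z b * (‖z‖ ^ 3)⁻¹)) * pd c (pd d φ) z := by
  have hg : ContDiff ℝ 1 (pd d φ) := contDiff_pd (n := 1) hφ d
  have hgc : HasCompactSupport (pd d φ) := hasCompactSupport_pd hφc d
  obtain ⟨C, -, hC⟩ := exists_bound_coord_mul_fderiv hg hgc
  have hint : Integrable fun z : E3 ↦ κ z * ((‖z‖ ^ 3)⁻¹ * (z a * (z b * pd c (pd d φ) z))) := by
    refine integrable_kernel_mul_of_le hκ hhom ?_ ?_ (C := C) fun z ↦ ?_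
    · exact (EuclideanSpace.proj (𝕜 := ℝ) a).continuous.mul
        ((EuclideanSpace.proj (𝕜 := ℝ) b).continuous.mul
          ((hg.continuous_fderiv one_ne_zero).clm_apply continuous_const))
    · refine (hgc.fderiv_apply (𝕜 := ℝ) (e c)).mono (support_subset_iff'.2 fun z hz ↦ ?_)
      have h0 : fderiv ℝ (pd d φ) z (e c) = 0 := notMem_support.1 hz
      simp only [pd] at h0 ⊢
      rw [h0]
      simp
    · rw [abs_mul]
      calc |z a| * |z b * pd c (pd d φ) z| ≤ ‖z‖ * (C * ‖e c‖) :=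
            mul_le_mul (abs_apply_le_norm z a) (hC z (e c) b) (abs_nonneg _) (norm_nonneg _)
        _ = C * ‖z‖ := by rw [show ‖e c‖ = 1 by simp [e]]; ring
  refine hint.congr (Eventually.of_forall fun z ↦ ?_)
  simp only
  ring

/-- (S_c2) in the index form `Σ_{i,m} ∫ K^{im}_κ ∂_i∂_m φ = φ(0) ∫_{S²} κ` (the kernel is symmetric in its indices).
[cite: MaoOhTao2023, Lemma 2.5 (S_c2)] -/
theorem sum_sum_integral_conicKernel_pd_pd_eq' (hκ : ContinuousOn κ {0}ᶜ)
    (hhom : ∀ y : E3, y ≠ 0 → ∀ t : ℝ, 0 < t → κ (t • y) = κ y) (hφ : ContDiff ℝ 2 φ)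
    (hφc : HasCompactSupport φ) :
    ∑ i, ∑ m, ∫ z : E3, κ z * (z i * (z m * (‖z‖ ^ 3)⁻¹)) * pd i (pd m φ) z =
      φ 0 * ∫ α, κ (α : E3) ∂(volume : Measure E3).toSphere := by
  rw [← sum_sum_integral_conicKernel_pd_pd_eq hκ hhom hφ hφc, Finset.sum_comm]
  refine Finset.sum_congr rfl fun m _ ↦ Finset.sum_congr rfl fun i _ ↦ ?_
  refine integral_congr_ae (ae_of_all _ fun z ↦ ?_)
  simp only
  ring

/-- **(T_c2), weak form**: for `φ ∈ C²_c(ℝ³)` and indices `j, k`,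
`Σ_{i,m} ∫ M^{ijm}_k(z) ∂_i∂_m φ(z) dz = δ_{jk} φ(0) ∫_{S²} κ dσ`,
`M^{ijm}_k = δ_{jk} K^{im}_κ + δ_{ik} K^{jm}_κ − δ_{mk} K^{ji}_κ` (the divergence form of `(K_κ)^{ij}_k`,
`ConicBogovskiiKernel.sum_pd_conicKernelT`), i.e. `Σ_i ∂_i (K_κ)^{ij}_k = δ^j_k (∫_{S²} κ) δ₀` in `𝒟'(ℝ³)`: the first
term is (S_c2), the other two cancel by the symmetry of `K^{ab}_κ` and of mixed partials.
[cite: MaoOhTao2023, Lemma 2.5 (T_c2) and Remark 2.6] -/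
theorem sum_sum_integral_conicKernelT_pd_pd_eq (hκ : ContinuousOn κ {0}ᶜ)
    (hhom : ∀ y : E3, y ≠ 0 → ∀ t : ℝ, 0 < t → κ (t • y) = κ y) (hφ : ContDiff ℝ 2 φ)
    (hφc : HasCompactSupport φ) (j k : Fin 3) :
    ∑ i, ∑ m, ∫ z : E3,
      ((if j = k then (1 : ℝ) else 0) * (κ z * (z i * (z m * (‖z‖ ^ 3)⁻¹)))
        + (if i = k then (1 : ℝ) else 0) * (κ z * (z j * (z m * (‖z‖ ^ 3)⁻¹)))
        - (if m = k then (1 : ℝ) else 0) * (κ z * (z j * (z i * (‖z‖ ^ 3)⁻¹)))) * pd i (pd m φ) z =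
      if j = k then φ 0 * ∫ α, κ (α : E3) ∂(volume : Measure E3).toSphere else 0 := by
  have hI := fun a b c d ↦ integrable_conicKernel_mul_pd_pd' hκ hhom hφ hφc a b c d
  -- split the integrals
  have hsplit : ∀ i m, ∫ z : E3,
      ((if j = k then (1 : ℝ) else 0) * (κ z * (z i * (z m * (‖z‖ ^ 3)⁻¹)))
        + (if i = k then (1 : ℝ) else 0) * (κ z * (z j * (z m * (‖z‖ ^ 3)⁻¹)))
        - (if m = k then (1 : ℝ) else 0) * (κ z * (z j * (z i * (‖z‖ ^ 3)⁻¹)))) * pd i (pd m φ) z =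
      (if j = k then (1 : ℝ) else 0) * (∫ z : E3, κ z * (z i * (z m * (‖z‖ ^ 3)⁻¹)) * pd i (pd m φ) z)
      + (if i = k then (1 : ℝ) else 0) * (∫ z : E3, κ z * (z j * (z m * (‖z‖ ^ 3)⁻¹)) * pd i (pd m φ) z)
      - (if m = k then (1 : ℝ) else 0) * (∫ z : E3, κ z * (z j * (z i * (‖z‖ ^ 3)⁻¹)) * pd i (pd m φ) z) := by
    intro i m
    have h1' := (hI i m i m).const_mul (if j = k then (1 : ℝ) else 0)
    have h2' := (hI j m i m).const_mul (if i = k then (1 : ℝ) else 0)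
    have h3' := (hI j i i m).const_mul (if m = k then (1 : ℝ) else 0)
    have h12 : Integrable fun z : E3 ↦
        (if j = k then (1 : ℝ) else 0) * (κ z * (z i * (z m * (‖z‖ ^ 3)⁻¹)) * pd i (pd m φ) z)
          + (if i = k then (1 : ℝ) else 0) * (κ z * (z j * (z m * (‖z‖ ^ 3)⁻¹)) * pd i (pd m φ) z) :=
      h1'.add h2'
    calc ∫ z : E3, ((if j = k then (1 : ℝ) else 0) * (κ z * (z i * (z m * (‖z‖ ^ 3)⁻¹)))
          + (if i = k then (1 : ℝ) else 0) * (κ z * (z j * (z m * (‖z‖ ^ 3)⁻¹)))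
          - (if m = k then (1 : ℝ) else 0) * (κ z * (z j * (z i * (‖z‖ ^ 3)⁻¹)))) * pd i (pd m φ) z
        = ∫ z : E3, ((if j = k then (1 : ℝ) else 0) * (κ z * (z i * (z m * (‖z‖ ^ 3)⁻¹)) * pd i (pd m φ) z)
            + (if i = k then (1 : ℝ) else 0) * (κ z * (z j * (z m * (‖z‖ ^ 3)⁻¹)) * pd i (pd m φ) z))
            - (if m = k then (1 : ℝ) else 0) * (κ z * (z j * (z i * (‖z‖ ^ 3)⁻¹)) * pd i (pd m φ) z) :=
          integral_congr_ae (ae_of_all _ fun z ↦ by beta_reduce; ring)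
      _ = _ := by
          rw [integral_sub h12 h3', integral_add h1' h2', integral_const_mul, integral_const_mul,
            integral_const_mul]
  simp_rw [hsplit]
  simp only [Finset.sum_add_distrib, Finset.sum_sub_distrib]
  -- the three sums
  have h1 : ∑ i, ∑ m, (if j = k then (1 : ℝ) else 0) *
      (∫ z : E3, κ z * (z i * (z m * (‖z‖ ^ 3)⁻¹)) * pd i (pd m φ) z) =
      (if j = k then (1 : ℝ) else 0) * (φ 0 * ∫ α, κ (α : E3) ∂(volume : Measure E3).toSphere) := by
    rw [← sum_sum_integral_conicKernel_pd_pd_eq' hκ hhom hφ hφc, Finset.mul_sum]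
    exact Finset.sum_congr rfl fun i _ ↦ (Finset.mul_sum _ _ _).symm
  have h2 : ∑ i, ∑ m, (if i = k then (1 : ℝ) else 0) *
      (∫ z : E3, κ z * (z j * (z m * (‖z‖ ^ 3)⁻¹)) * pd i (pd m φ) z) =
      ∑ m, ∫ z : E3, κ z * (z j * (z m * (‖z‖ ^ 3)⁻¹)) * pd k (pd m φ) z := by
    have : ∀ i, ∑ m, (if i = k then (1 : ℝ) else 0) *
        (∫ z : E3, κ z * (z j * (z m * (‖z‖ ^ 3)⁻¹)) * pd i (pd m φ) z) =
        if i = k then ∑ m, ∫ z : E3, κ z * (z j * (z m * (‖z‖ ^ 3)⁻¹)) * pd i (pd m φ) z else 0 := by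
      intro i
      rw [← Finset.mul_sum, boole_mul]
    rw [Finset.sum_congr rfl fun i _ ↦ this i, Finset.sum_ite_eq' Finset.univ k, if_pos (Finset.mem_univ k)]
  have h3 : ∑ i, ∑ m, (if m = k then (1 : ℝ) else 0) *
      (∫ z : E3, κ z * (z j * (z i * (‖z‖ ^ 3)⁻¹)) * pd i (pd m φ) z) =
      ∑ i, ∫ z : E3, κ z * (z j * (z i * (‖z‖ ^ 3)⁻¹)) * pd i (pd k φ) z := by
    refine Finset.sum_congr rfl fun i _ ↦ ?_
    simp_rw [boole_mul]
    rw [Finset.sum_ite_eq' Finset.univ k, if_pos (Finset.mem_univ k)]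
  -- the second and third sums cancel: mixed partials commute
  have h23 : ∑ m, ∫ z : E3, κ z * (z j * (z m * (‖z‖ ^ 3)⁻¹)) * pd k (pd m φ) z =
      ∑ i, ∫ z : E3, κ z * (z j * (z i * (‖z‖ ^ 3)⁻¹)) * pd i (pd k φ) z := by
    refine Finset.sum_congr rfl fun m _ ↦ integral_congr_ae (ae_of_all _ fun z ↦ ?_)
    simp only
    rw [pd_pd_comm hφ.contDiffAt k m]
  rw [h1, h2, h3, h23, add_sub_cancel_right]
  split_ifs <;> simp

/-- **(T_c2), weak form, against a translate**: for `f ∈ C²_c(ℝ³)` and `x ∈ ℝ³`,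
`Σ_{i,m} ∫ M^{ijm}_k(z) (∂_i∂_m f)(x − z) dz = δ_{jk} f(x) ∫_{S²} κ dσ`. [cite: MaoOhTao2023, Lemma 2.5 (T_c2)] -/
theorem sum_sum_integral_conicKernelT_pd_pd_sub_eq (hκ : ContinuousOn κ {0}ᶜ)
    (hhom : ∀ y : E3, y ≠ 0 → ∀ t : ℝ, 0 < t → κ (t • y) = κ y) {f : E3 → ℝ} (hf : ContDiff ℝ 2 f)
    (hfc : HasCompactSupport f) (x : E3) (j k : Fin 3) :
    ∑ i, ∑ m, ∫ z : E3,
      ((if j = k then (1 : ℝ) else 0) * (κ z * (z i * (z m * (‖z‖ ^ 3)⁻¹)))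
        + (if i = k then (1 : ℝ) else 0) * (κ z * (z j * (z m * (‖z‖ ^ 3)⁻¹)))
        - (if m = k then (1 : ℝ) else 0) * (κ z * (z j * (z i * (‖z‖ ^ 3)⁻¹)))) * pd i (pd m f) (x - z) =
      if j = k then f x * ∫ α, κ (α : E3) ∂(volume : Measure E3).toSphere else 0 := by
  have hψ : ContDiff ℝ 2 (fun y : E3 ↦ f (x - y)) := hf.comp (contDiff_const.sub contDiff_id)
  obtain ⟨R, hR⟩ := hfc.isCompact.isBounded.subset_closedBall 0
  have hψc : HasCompactSupport (fun y : E3 ↦ f (x - y)) := by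
    refine HasCompactSupport.intro (isCompact_closedBall x R) fun y hy ↦ eq_zero_of_lt_norm hR ?_
    rw [mem_closedBall, not_le, dist_eq_norm] at hy
    rwa [← norm_neg, neg_sub]
  have key := sum_sum_integral_conicKernelT_pd_pd_eq hκ hhom hψ hψc j k
  simp only [sub_zero] at key
  rw [← key]
  refine Finset.sum_congr rfl fun i _ ↦ Finset.sum_congr rfl fun m _ ↦ ?_
  refine integral_congr_ae (ae_of_all _ fun z ↦ ?_)
  simp only
  rw [pd_pd_comp_const_sub hf x z m i]

/-- The kernels `M^{ijm}_k` of the divergence form of `T_c` are locally integrable. [folklore] -/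
theorem locallyIntegrable_conicKernelT (hκ : ContinuousOn κ {0}ᶜ)
    (hhom : ∀ y : E3, y ≠ 0 → ∀ t : ℝ, 0 < t → κ (t • y) = κ y) (i j k m : Fin 3) :
    LocallyIntegrable (fun z : E3 ↦
      (if j = k then (1 : ℝ) else 0) * (κ z * (z i * (z m * (‖z‖ ^ 3)⁻¹)))
        + (if i = k then (1 : ℝ) else 0) * (κ z * (z j * (z m * (‖z‖ ^ 3)⁻¹)))
        - (if m = k then (1 : ℝ) else 0) * (κ z * (z j * (z i * (‖z‖ ^ 3)⁻¹)))) volume :=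
  (((locallyIntegrable_conicKernel hκ hhom i m).smul (if j = k then (1 : ℝ) else 0)).add
    ((locallyIntegrable_conicKernel hκ hhom j m).smul (if i = k then (1 : ℝ) else 0))).sub
    ((locallyIntegrable_conicKernel hκ hhom j i).smul (if m = k then (1 : ℝ) else 0))

/-- **(T_c2): `∂_i (T_c 𝐟)^{ij} = 𝐟^j`** for the conic vector operator in divergence form,
`(T_c 𝐟)^{ij}(x) = Σ_{k,m} (M^{ijm}_k ⋆ ∂_m 𝐟^k)(x)`, `𝐟 ∈ C²_c(ℝ³; ℝ³)` (components `𝐟 k`), and a profile `κ` continuous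
and `0`-homogeneous off the origin: `Σ_i ∂_i (T_c 𝐟)^{ij}(x) = 𝐟^j(x) ∫_{S²} κ dσ` for every `x` (`= 𝐟^j(x)` for a
normalised profile, `…_eq_self`). The derivative falls on the field (`pd_convolution_eq`) and the weak identity
`sum_sum_integral_conicKernelT_pd_pd_sub_eq` applies to each component.
[cite: MaoOhTao2023, Lemma 2.5 (T_c2) and Remark 2.6] -/
theorem sum_pd_convolution_conicKernelT_eq (hκ : ContinuousOn κ {0}ᶜ)
    (hhom : ∀ y : E3, y ≠ 0 → ∀ t : ℝ, 0 < t → κ (t • y) = κ y) {F : Fin 3 → E3 → ℝ}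
    (hF : ∀ k, ContDiff ℝ 2 (F k)) (hFc : ∀ k, HasCompactSupport (F k)) (j : Fin 3) (x : E3) :
    ∑ i, pd i (fun y : E3 ↦ ∑ k, ∑ m,
      ((fun z : E3 ↦
        (if j = k then (1 : ℝ) else 0) * (κ z * (z i * (z m * (‖z‖ ^ 3)⁻¹)))
          + (if i = k then (1 : ℝ) else 0) * (κ z * (z j * (z m * (‖z‖ ^ 3)⁻¹)))
          - (if m = k then (1 : ℝ) else 0) * (κ z * (z j * (z i * (‖z‖ ^ 3)⁻¹))))
        ⋆[ContinuousLinearMap.mul ℝ ℝ, volume] pd m (F k)) y) x =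
      F j x * ∫ α, κ (α : E3) ∂(volume : Measure E3).toSphere := by
  have hg : ∀ k m, ContDiff ℝ 1 (pd m (F k)) := fun k m ↦ contDiff_pd (n := 1) (hF k) m
  have hgc : ∀ k m, HasCompactSupport (pd m (F k)) := fun k m ↦ hasCompactSupport_pd (hFc k) m
  have hM := fun i k m ↦ locallyIntegrable_conicKernelT hκ hhom i j k m
  have hdiff : ∀ i k m, DifferentiableAt ℝ
      ((fun z : E3 ↦
        (if j = k then (1 : ℝ) else 0) * (κ z * (z i * (z m * (‖z‖ ^ 3)⁻¹)))
          + (if i = k then (1 : ℝ) else 0) * (κ z * (z j * (z m * (‖z‖ ^ 3)⁻¹)))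
          - (if m = k then (1 : ℝ) else 0) * (κ z * (z j * (z i * (‖z‖ ^ 3)⁻¹))))
        ⋆[ContinuousLinearMap.mul ℝ ℝ, volume] pd m (F k)) x := fun i k m ↦
    ((hgc k m).hasFDerivAt_convolution_right (ContinuousLinearMap.mul ℝ ℝ) (hM i k m)
      (hg k m) x).differentiableAt
  -- differentiate term by term, the derivative falling on the field
  have hpd : ∀ i, pd i (fun y : E3 ↦ ∑ k, ∑ m,
      ((fun z : E3 ↦
        (if j = k then (1 : ℝ) else 0) * (κ z * (z i * (z m * (‖z‖ ^ 3)⁻¹)))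
          + (if i = k then (1 : ℝ) else 0) * (κ z * (z j * (z m * (‖z‖ ^ 3)⁻¹)))
          - (if m = k then (1 : ℝ) else 0) * (κ z * (z j * (z i * (‖z‖ ^ 3)⁻¹))))
        ⋆[ContinuousLinearMap.mul ℝ ℝ, volume] pd m (F k)) y) x =
      ∑ k, ∑ m, ∫ z : E3,
        ((if j = k then (1 : ℝ) else 0) * (κ z * (z i * (z m * (‖z‖ ^ 3)⁻¹)))
          + (if i = k then (1 : ℝ) else 0) * (κ z * (z j * (z m * (‖z‖ ^ 3)⁻¹)))
          - (if m = k then (1 : ℝ) else 0) * (κ z * (z j * (z i * (‖z‖ ^ 3)⁻¹)))) *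
          pd i (pd m (F k)) (x - z) := by
    intro i
    rw [pd_sum _ _ fun k _ ↦ DifferentiableAt.fun_sum fun m _ ↦ hdiff i k m]
    refine Finset.sum_congr rfl fun k _ ↦ ?_
    rw [pd_sum _ _ fun m _ ↦ hdiff i k m]
    refine Finset.sum_congr rfl fun m _ ↦ ?_
    rw [pd_convolution_eq (hM i k m) (hg k m) (hgc k m) i x, convolution_mul]
  rw [Finset.sum_congr rfl fun i _ ↦ hpd i, Finset.sum_comm,
    Finset.sum_congr rfl fun k _ ↦ sum_sum_integral_conicKernelT_pd_pd_sub_eq hκ hhom (hF k) (hFc k) x j k,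
    Finset.sum_ite_eq Finset.univ j, if_pos (Finset.mem_univ j)]

/-- **(T_c2), normalised profile**: `Σ_i ∂_i (T_c 𝐟)^{ij} = 𝐟^j` on `ℝ³` when `∫_{S²} κ dσ = 1`.
[cite: MaoOhTao2023, Lemma 2.5 (T_c2)] -/
theorem sum_pd_convolution_conicKernelT_eq_self (hκ : ContinuousOn κ {0}ᶜ)
    (hhom : ∀ y : E3, y ≠ 0 → ∀ t : ℝ, 0 < t → κ (t • y) = κ y)
    (hκ1 : ∫ α, κ (α : E3) ∂(volume : Measure E3).toSphere = 1) {F : Fin 3 → E3 → ℝ}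
    (hF : ∀ k, ContDiff ℝ 2 (F k)) (hFc : ∀ k, HasCompactSupport (F k)) (j : Fin 3) (x : E3) :
    ∑ i, pd i (fun y : E3 ↦ ∑ k, ∑ m,
      ((fun z : E3 ↦
        (if j = k then (1 : ℝ) else 0) * (κ z * (z i * (z m * (‖z‖ ^ 3)⁻¹)))
          + (if i = k then (1 : ℝ) else 0) * (κ z * (z j * (z m * (‖z‖ ^ 3)⁻¹)))
          - (if m = k then (1 : ℝ) else 0) * (κ z * (z j * (z i * (‖z‖ ^ 3)⁻¹))))
        ⋆[ContinuousLinearMap.mul ℝ ℝ, volume] pd m (F k)) y) x = F j x := by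
  rw [sum_pd_convolution_conicKernelT_eq hκ hhom hF hFc j x, hκ1, mul_one]

/-- **(T_c1) for the divergence form**: if `κ` is supported in a convex cone `C` (closed under addition) and
`C` contains the topological supports of the components `𝐟^k`, then every `(T_c 𝐟)^{ij}` is supported in `C`
(the kernels `M^{ijm}_k` are multiples of `κ`, and `supp ∂_m 𝐟^k ⊆ tsupp 𝐟^k`). [cite: MaoOhTao2023, Lemma 2.5 (T_c1)] -/
theorem support_convolution_conicKernelT_subset {C : Set E3} (hC : ∀ a ∈ C, ∀ b ∈ C, a + b ∈ C)
    (hκC : ∀ z, κ z ≠ 0 → z ∈ C) {F : Fin 3 → E3 → ℝ} (hFC : ∀ k, tsupport (F k) ⊆ C) (i j : Fin 3) :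
    support (fun y : E3 ↦ ∑ k, ∑ m,
      ((fun z : E3 ↦
        (if j = k then (1 : ℝ) else 0) * (κ z * (z i * (z m * (‖z‖ ^ 3)⁻¹)))
          + (if i = k then (1 : ℝ) else 0) * (κ z * (z j * (z m * (‖z‖ ^ 3)⁻¹)))
          - (if m = k then (1 : ℝ) else 0) * (κ z * (z j * (z i * (‖z‖ ^ 3)⁻¹))))
        ⋆[ContinuousLinearMap.mul ℝ ℝ, volume] pd m (F k)) y) ⊆ C := by
  intro y hy
  rw [mem_support] at hy
  obtain ⟨k, -, hk⟩ := Finset.exists_ne_zero_of_sum_ne_zero hy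
  obtain ⟨m, -, hm⟩ := Finset.exists_ne_zero_of_sum_ne_zero hk
  have hsub := support_convolution_subset (μ := (volume : Measure E3)) (ContinuousLinearMap.mul ℝ ℝ)
    (f := fun z : E3 ↦
        (if j = k then (1 : ℝ) else 0) * (κ z * (z i * (z m * (‖z‖ ^ 3)⁻¹)))
          + (if i = k then (1 : ℝ) else 0) * (κ z * (z j * (z m * (‖z‖ ^ 3)⁻¹)))
          - (if m = k then (1 : ℝ) else 0) * (κ z * (z j * (z i * (‖z‖ ^ 3)⁻¹))))
    (g := pd m (F k)) (mem_support.2 hm)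
  obtain ⟨a, ha, b, hb, hab⟩ := hsub
  rw [← hab]
  refine hC a (hκC a fun h0 ↦ mem_support.1 ha ?_) b (hFC k ?_)
  · simp [h0]
  · refine support_fderiv_subset ℝ (mem_support.2 fun h0 ↦ mem_support.1 hb ?_)
    simp only [pd]
    rw [h0]
    rfl

end VectorOperator

end MaoOhTao

end Literature.Geometry.Lorentzian

end
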